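import Mathlib
import Summits.CriticalPhenomena.PercolationContinuityZ3.Theorems.PercNearOneGluingNoHeavyLowerTailThreeFamilyTripleHall

/-!
# Conjecture O for cyclic selections: distinct good representatives (unconditional)

Helper file for crux `stmt-CriticalPhenomena-4575` (`NoHeavyLowerTail`, route `PercNearOneGluingNoHeavy`),
new-inequality factory seat `prim-ineq-gen-3` (gen 9).  Everything here is PROVED.

`OrientedAntipodalHall.card_le_card_goods_above_cyclic_holds` (the capacity-one Hall COUNT for the bads of a cyclic
selection `(i,j), (j,l), (l,i)`, now unconditional via `MS3-down` = Theorem A′ + TRIPLE-0) is turned into the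
SDR form of Conjecture O(cyclic): the antipodal bads of the three cyclic types admit DISTINCT good sets above them.
This is the three-type analogue of `exists_injective_good_above_chain` (gen 5) and completes Conjecture O for every
opposite-free class of at most three ordered types (stars and chains: p195424, p202923; cyclic triples: here).
(prim-ineq-gen-3 gen 9, 2026-08-20; memo `run/shared/lean/prim/prim-ineq-gen-3/PROOF-TRIPLE0.md`.)
-/

namespace Summit.CriticalPhenomena.PercolationContinuityZ3.Theorems

namespace OrientedAntipodalHall

open Finset AntipodalStrongHarris AntipodalStrongHarris.Lab

variable {α : Type*} [DecidableEq α] {k : ℕ}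

/-- **Conjecture O for cyclic selections (SDR form), unconditional.**  For a monotone `Lab`-labeling and three
families of antipodal bads of the cyclic types `(i,j), (j,l), (l,i)` inside `S`, there is an injective assignment
of a good set `φ X ⊇ X` (`f (φ X) = top`, `f (S \ φ X) = bot`) to every bad `X ∈ D₁ ∪ D₂ ∪ D₃`. -/
theorem exists_injective_good_above_cyclic (S : Finset α) {f : Finset α → Lab k}
    (hf : ∀ ⦃X Y : Finset α⦄, X ⊆ Y → f X ≤ f Y) (D₁ D₂ D₃ : Finset (Finset α)) {i j l : Fin k}
    (hij : i ≠ j) (hjl : j ≠ l) (hil : i ≠ l)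
    (h₁S : ∀ X ∈ D₁, X ⊆ S) (h₁i : ∀ X ∈ D₁, f X = petal i) (h₁j : ∀ X ∈ D₁, f (S \ X) = petal j)
    (h₂S : ∀ X ∈ D₂, X ⊆ S) (h₂j : ∀ X ∈ D₂, f X = petal j) (h₂l : ∀ X ∈ D₂, f (S \ X) = petal l)
    (h₃S : ∀ X ∈ D₃, X ⊆ S) (h₃l : ∀ X ∈ D₃, f X = petal l) (h₃i : ∀ X ∈ D₃, f (S \ X) = petal i) :
    ∃ φ : ↥(D₁ ∪ D₂ ∪ D₃) → Finset α, Function.Injective φ ∧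
      ∀ X : ↥(D₁ ∪ D₂ ∪ D₃), (X : Finset α) ⊆ φ X ∧ φ X ⊆ S ∧ f (φ X) = top ∧ f (S \ φ X) = bot := by
  classical
  let t : ↥(D₁ ∪ D₂ ∪ D₃) → Finset (Finset α) := fun X =>
    {U ∈ S.powerset | f U = top ∧ f (S \ U) = bot ∧ (X : Finset α) ⊆ U}
  have hHall : ∀ s : Finset ↥(D₁ ∪ D₂ ∪ D₃), #s ≤ #(s.biUnion t) := by
    intro s
    set D' : Finset (Finset α) := s.map (Function.Embedding.subtype _) with hD'
    have hD'sub : ∀ X ∈ D', X ∈ D₁ ∪ D₂ ∪ D₃ := by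
      intro X hX
      obtain ⟨x, -, rfl⟩ := mem_map.mp hX
      exact x.2
    -- split the sub-family along the three types
    set E₁ : Finset (Finset α) := D'.filter (· ∈ D₁) with hE₁
    set E₂ : Finset (Finset α) := (D'.filter (· ∉ D₁)).filter (· ∈ D₂) with hE₂
    set E₃ : Finset (Finset α) := (D'.filter (· ∉ D₁)).filter (· ∉ D₂) with hE₃
    have hE₁sub : ∀ X ∈ E₁, X ∈ D₁ := fun X hX => (mem_filter.mp hX).2
    have hE₂sub : ∀ X ∈ E₂, X ∈ D₂ := fun X hX => (mem_filter.mp hX).2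
    have hE₃sub : ∀ X ∈ E₃, X ∈ D₃ := by
      intro X hX
      obtain ⟨hX', hX2⟩ := mem_filter.mp hX
      obtain ⟨hXD', hX1⟩ := mem_filter.mp hX'
      rcases mem_union.mp (hD'sub X hXD') with h | h
      · rcases mem_union.mp h with h | h
        · exact absurd h hX1
        · exact absurd h hX2
      · exact h
    have hcard : #s = #E₁ + #E₂ + #E₃ := by
      rw [hE₁, hE₂, hE₃, add_assoc, card_filter_add_card_filter_not, card_filter_add_card_filter_not]
      exact (card_map _).symm
    have hle := card_le_card_goods_above_cyclic_holds S hf E₁ E₂ E₃ hij hjl hil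
      (fun X hX => h₁S X (hE₁sub X hX)) (fun X hX => h₁i X (hE₁sub X hX))
      (fun X hX => h₁j X (hE₁sub X hX)) (fun X hX => h₂S X (hE₂sub X hX))
      (fun X hX => h₂j X (hE₂sub X hX)) (fun X hX => h₂l X (hE₂sub X hX))
      (fun X hX => h₃S X (hE₃sub X hX)) (fun X hX => h₃l X (hE₃sub X hX))
      (fun X hX => h₃i X (hE₃sub X hX))
    have hED' : ∀ X ∈ E₁ ∪ E₂ ∪ E₃, X ∈ D' := by
      intro X hX
      rcases mem_union.mp hX with h | h
      · rcases mem_union.mp h with h | h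
        · exact (mem_filter.mp h).1
        · exact (mem_filter.mp (mem_filter.mp h).1).1
      · exact (mem_filter.mp (mem_filter.mp h).1).1
    have hgoods : {U ∈ S.powerset | f U = top ∧ f (S \ U) = bot ∧ ∃ X ∈ E₁ ∪ E₂ ∪ E₃, X ⊆ U} ⊆
        s.biUnion t := by
      intro U hU
      rw [mem_filter, mem_powerset] at hU
      obtain ⟨hUS, hUtop, hUbot, X, hX, hXU⟩ := hU
      obtain ⟨x, hx, rfl⟩ := mem_map.mp (hED' X hX)
      rw [mem_biUnion]
      refine ⟨x, hx, ?_⟩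
      simp only [t, mem_filter, mem_powerset]
      exact ⟨hUS, hUtop, hUbot, hXU⟩
    calc #s = #E₁ + #E₂ + #E₃ := hcard
      _ ≤ #{U ∈ S.powerset | f U = top ∧ f (S \ U) = bot ∧ ∃ X ∈ E₁ ∪ E₂ ∪ E₃, X ⊆ U} := hle
      _ ≤ #(s.biUnion t) := card_le_card hgoods
  obtain ⟨φ, hφinj, hφ⟩ := (all_card_le_biUnion_card_iff_exists_injective t).mp hHall
  refine ⟨φ, hφinj, fun X => ?_⟩
  have hX := hφ X
  simp only [t, mem_filter, mem_powerset] at hX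
  exact ⟨hX.2.2.2, hX.1, hX.2.1, hX.2.2.1⟩

end OrientedAntipodalHall

end Summit.CriticalPhenomena.PercolationContinuityZ3.Theorems
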